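import Literature.NumberTheory.LFunctions.DeBruijnNewman
import HarnessLib

/-!
# Pólya (1926): the "fake" `Ξ`-function has only real zeros

Named fact (D-0014) requested by route RiemannHypothesis/LeeYang, crux #2 (calibration;
`wi-03965`), next to the de Bruijn–Newman vocabulary (`Literature.NumberTheory.LFunctions.HasOnlyRealZeros`,
`DeBruijnNewman.lean`).

Riemann's `Ξ(z) = ∫_0^∞ Φ(u) cos(zu) du` with
`Φ(u) = Σ_n (4π²n⁴e^{9u/2} - 6πn²e^{5u/2}) e^{-πn²e^{2u}}` (even in `u`). Replacing `Φ` by the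
symmetrisation of its leading term as `u → +∞`, Pólya considered
`Φ*(u) ∝ cosh(9u/2) e^{-2π cosh 2u}` and the "verfälschte" `Ξ`-function
`Ξ*(z) = ∫_0^∞ cosh(9u/2) e^{-2π cosh 2u} cos(zu) du`
`  = ½ (K_{9/4 + iz/2}(2π) + K_{9/4 - iz/2}(2π))`,
and proved that **all zeros of `Ξ*` are real** (G. Pólya, *Bemerkung über die
Integraldarstellung der Riemannschen ξ-Funktion*, Acta Math. 48 (1926) 305–317, main theorem; reported in Titchmarsh, *The Theory of the Riemann Zeta-Function*, 2nd ed. (1986),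
Ch. X). Constant positive factors do not affect the zero set, so we state it for the integrand
`cosh(9u/2) e^{-2π cosh 2u}` exactly as the route's request spells it.

## References

* G. Pólya, Acta Math. 48 (1926) 305–317 [Polya1926].
* E. C. Titchmarsh, *The Theory of the Riemann Zeta-Function*, 2nd ed. (rev. Heath-Brown), OUP
  1986, Ch. X [Titchmarsh1986].
-/

noncomputable section

open Complex MeasureTheory Real

namespace Literature.NumberTheory.LFunctions

/-- Pólya's kernel `Φ*(u) = cosh(9u/2) · e^{-2π cosh 2u}` (the symmetrised leading term of
Riemann's `Φ`, up to a positive constant). [Pólya 1926; Titchmarsh 1986, Ch. X] [folklore] -/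
def polyaFakePhi (u : ℝ) : ℝ :=
  Real.cosh (9 * u / 2) * Real.exp (-2 * π * Real.cosh (2 * u))

/-- Pólya's "fake" `Ξ`-function `Ξ*(z) = ∫_0^∞ Φ*(u) cos(zu) du`
(`= ½ (K_{9/4+iz/2}(2π) + K_{9/4-iz/2}(2π))`). [Pólya 1926; Titchmarsh 1986, Ch. X]
[folklore] -/
def polyaFakeXi (z : ℂ) : ℂ :=
  ∫ u in Set.Ioi (0 : ℝ), (polyaFakePhi u : ℂ) * Complex.cos (z * u)

/-- `Φ*` is positive. [folklore] -/
theorem polyaFakePhi_pos (u : ℝ) : 0 < polyaFakePhi u :=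
  mul_pos (Real.cosh_pos _) (Real.exp_pos _)

/-- `Φ*` is even. [folklore] -/
theorem polyaFakePhi_neg (u : ℝ) : polyaFakePhi (-u) = polyaFakePhi u := by
  simp [polyaFakePhi, mul_neg, neg_div]

/-- Unfolding to the integrand of the request. [folklore] -/
theorem polyaFakeXi_eq (z : ℂ) : polyaFakeXi z =
    ∫ u in Set.Ioi (0 : ℝ),
      ((Real.cosh (9 * u / 2) * Real.exp (-2 * π * Real.cosh (2 * u)) : ℝ) : ℂ) *
        Complex.cos (z * u) := rfl

/-- **Pólya (1926): the fake `Ξ`-function has only real zeros.** Every zero of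
`z ↦ ∫_0^∞ cosh(9u/2) e^{-2π cosh 2u} cos(zu) du` is real.
[cite: Polya1926, main theorem (all zeros of Ξ* real)] [cite: Titchmarsh1986, Ch. X] -/
def polya_fakeXi_real_zeros : Prop :=
  HasOnlyRealZeros polyaFakeXi

end Literature.NumberTheory.LFunctions

end
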